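import Summits.HodgeConjecture.CorCM.GaloisNonNormalPrimeOrderQuotient
import Summits.HodgeConjecture.CorCM.GaloisNonNormalPrimeOrderOrbits
import HarnessLib

/-!
# A NON-NORMAL SUBGROUP OF PRIME ORDER IN A CM QUOTIENT makes the field BAD — under the REFINED count

COR-CM (cell `pub-hodgecm2`), binder seat b04 (gen 39), count-neutral own lane «Galois-CM-type classification».  KERNEL ONLY:
theorems; no definition, no named fact, no `sorry`.  `HC_CM` is neither used nor claimed.

Gen 38's `CorCM/GaloisNonNormalPrimeOrderQuotient` transports gen 33's prime-order criterion to every CM quotient `Gal(K/ℚ)/N`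
(`N ◁ Gal(K/ℚ)`, complex conjugation `∉ N`) under gen 33's size condition `16 ≤ n`, `8p ≤ 2^(n/4)` (`[Gal:N] = 2pn`).  Here the size
condition is replaced by the refined count of gen 39 (`CorCM/GaloisSkewSectionPrimeOrbits`, `CorCM/GaloisNonNormalPrimeOrderOrbits`):

  `(2pn - 1 - m(p-1))·2^(n/2) + m(p-1)·2^((n + (p-1)(n/m))/p) < 2^n`   for every `m ≥ 2` dividing `n`,

which holds in particular for `p = 5, 7` at `n = 16` (`SkewSectionPrime.count'_five`, `count'_seven`).  The proof is gen 38's verbatim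
(restriction `Gal(K/ℚ)/N ≃ Gal(K^N/ℚ)`, `K^N` a Galois CM field of degree `[Gal:N]`, BAD ascends by gen 32's monotonicity
`GaloisModels.exists_simple_degenerate_of_fixedField_of_ne_bot`).  Consumer: `CorCM/GaloisNormalSylowThirtyTwo` (gen 39: the Sylow
`p`-subgroups of the Galois group of a GOOD field of degree divisible by `32` are normal, for every odd prime `p`).

* `exists_simple_degenerate_of_nonnormal_prime_order_mod'` — `[Gal:N] = 2pn`, refined count, `y ∉ N`, `yᵖ ∈ N`, `g y g⁻¹ y⁻ᵏ ∉ N`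
  (`k < p`) ⟹ `K` carries a SIMPLE DEGENERATE abelian variety of dimension `[K:ℚ]/2`.
* `exists_conj_pow_mod_of_forall_isNondegenerate'` — contrapositive: in a GOOD field every subgroup of order `p` of such a CM quotient
  is normal.

## References

* [Shimura1998] G. Shimura, *Abelian Varieties with Complex Multiplication and Modular Functions*, §6.2 Thm. 3, §8.2 Prop. 26, §32.10.
* [Kubota1965] T. Kubota, *On the field extension by complex multiplication*, Trans. AMS 118 (1965), §2, §4 Lemma 2.
* [Gordon1999HodgeAVSurvey] B. B. Gordon, *A survey of the Hodge conjecture for abelian varieties*, Thm. 6.4, §9.3.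
-/

noncomputable section

open CategoryTheory CategoryTheory.Limits NumberField
open scoped BigOperators

namespace Summit.HodgeConjecture.CorCM.GaloisModels

open Literature.NumberTheory.ComplexMultiplication
open Literature.AlgebraicGeometry.Motives (AbelianVariety CMType)
open Literature.AlgebraicGeometry.HodgeTheory
open Literature.AlgebraicGeometry.ComplexMultiplication (IsCMTypeRealisation)
open Literature.AlgebraicGeometry.Pohlmann1968
open Literature.Barriers.HodgeConjecture (divisorClassesSpan)
open Summit.HodgeConjecture.CorCM.GaloisRank

variable {K : Type} [Field K] [NumberField K] [IsCMField K] [IsGalois ℚ K]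

/-- **A NON-NORMAL SUBGROUP OF PRIME ORDER IN A CM QUOTIENT ⟹ BAD.**  `N ◁ Gal(K/ℚ)` with complex conjugation `∉ N` and
`[Gal:N] = 2pn`, the refined count of `CorCM/GaloisSkewSectionPrimeOrbits` for all `m ≥ 2` dividing `n`; if `y ∉ N`, `yᵖ ∈ N` and `g y g⁻¹ y⁻ᵏ ∉ N` for all `k < p` (so `y mod N` has order `p` in
`Gal(K^N/ℚ) = Gal/N` and generates a NON-normal subgroup), then `K` carries a SIMPLE DEGENERATE abelian variety of dimension `[K:ℚ]/2`
with a rational `(p,p)` class outside the divisor ring on some power. [cite: Shimura1998, §6.2 Thm. 3, §8.2 Prop. 26 and §32.10]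
[cite: Kubota1965, §2 and §4 Lemma 2] [cite: Gordon1999HodgeAVSurvey, Thm. 6.4 and §9.3] -/
theorem exists_simple_degenerate_of_nonnormal_prime_order_mod' (N : Subgroup (K ≃ₐ[ℚ] K)) [N.Normal]
    (hc : (IsCMField.complexConj K).restrictScalars ℚ ∉ N) (p n : ℕ) [hp : Fact p.Prime] (hidx : N.index = 2 * p * n)
    (hcount : ∀ m, 2 ≤ m → m ∣ n →
      (2 * p * n - 1 - m * (p - 1)) * 2 ^ (n / 2) + m * (p - 1) * 2 ^ ((n + (p - 1) * (n / m)) / p) < 2 ^ n)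
    (y g : K ≃ₐ[ℚ] K) (hy : y ∉ N) (hyp : y ^ p ∈ N)
    (hg : ∀ k < p, g * y * g⁻¹ * (y ^ k)⁻¹ ∉ N) :
    ∃ (Φ : CMType K) (φ : K →+* ℂ) (X : AbelianVariety ℂ) (ι : 𝓞 K →+* End X)
      (ϑ : K →+* Module.End ℂ (complexBetti X.X 1)),
      IsPrimitive (ℂ ≃+* ℂ) Φ.1 φ ∧ ¬ IsNondegenerate Φ ∧ IsCMTypeRealisation Φ X ι ϑ ∧ X.IsSimple ∧
      X.dim = Module.finrank ℚ K / 2 ∧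
      ∃ m p : ℕ, ∃ z : complexBetti (⨁ fun _ : Fin m => X).X (2 * p), IsRationalClass z ∧
        IsOfHodgeType (⨁ fun _ : Fin m => X).dim (⨁ fun _ : Fin m => X).X (2 * p) p p z ∧
        z ∉ divisorClassesSpan (⨁ fun _ : Fin m => X).X (⨁ fun _ : Fin m => X).dim p := by
  classical
  by_cases hN : N = ⊥
  · subst hN
    have hy1 : y ≠ 1 := fun h => hy (Subgroup.mem_bot.2 h)
    have hyp' : y ^ p = 1 := Subgroup.mem_bot.1 hyp
    have hnn : ∃ τ : K ≃ₐ[ℚ] K, ∀ k < p, τ * y * τ⁻¹ ≠ y ^ k :=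
      ⟨g, fun k hk h => hg k hk (Subgroup.mem_bot.2 (by rw [h, mul_inv_cancel]))⟩
    have hdeg : Module.finrank ℚ K = 2 * p * n := by
      rw [← hidx, Subgroup.index_bot, IsGalois.card_aut_eq_finrank]
    obtain ⟨Φ, φ₀, A, ι, θ, H1, H2, H3, H4, H5, H6⟩ :=
      exists_simple_degenerate_of_nonnormal_prime_order_gal' y p n hyp' hy1 hnn hdeg hcount
    exact ⟨Φ, φ₀, A, ι, θ, H1, H2, H3, H4, H5, H6⟩
  haveI : IsCMField (IntermediateField.fixedField N) := isCMField_fixedField_of_not_mem N hc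
  haveI : IsGalois ℚ (IntermediateField.fixedField N) := IsGalois.of_fixedField_normal_subgroup N
  -- `Gal(K/ℚ)/N ≃ Gal(K^N/ℚ)` (restriction), composed with the quotient map
  set π := QuotientGroup.mk' N with hπ
  set E := IsGalois.normalAutEquivQuotient (K := ℚ) (L := K) N with hE
  have hker : ∀ σ : K ≃ₐ[ℚ] K, E (π σ) = 1 ↔ σ ∈ N := fun σ => by
    rw [E.map_eq_one_iff, hπ, QuotientGroup.mk'_apply, QuotientGroup.eq_one_iff]
  have hyp' : E (π y) ^ p = 1 := by rw [← map_pow, ← map_pow, (hker _).2 hyp]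
  have hy1 : E (π y) ≠ 1 := fun h => hy ((hker y).1 h)
  have hnn : ∃ τ, ∀ k < p, τ * E (π y) * τ⁻¹ ≠ E (π y) ^ k := by
    refine ⟨E (π g), fun k hk h => hg k hk ((hker _).1 ?_)⟩
    simp only [map_mul, map_inv, map_pow]
    rw [h, mul_inv_cancel]
  have hdeg : Module.finrank ℚ (IntermediateField.fixedField N) = 2 * p * n := by
    rw [finrank_fixedField_eq_index N, hidx]
  obtain ⟨Φ₀, φ₀, A, ι, θ, hprim, hndg, -⟩ :=
    exists_simple_degenerate_of_nonnormal_prime_order_gal' (E (π y)) p n hyp' hy1 hnn hdeg hcount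
  exact exists_simple_degenerate_of_fixedField_of_ne_bot N hc hN Φ₀ φ₀ hprim hndg

/-- **In a GOOD Galois CM field, every subgroup of prime order of every CM quotient of the Galois group is normal**: `N ◁ Gal(K/ℚ)`,
`c ∉ N`, `[Gal:N] = 2pn`, the refined count of `CorCM/GaloisSkewSectionPrimeOrbits` for all `m ≥ 2` dividing `n`; if `y ∉ N`, `yᵖ ∈ N`, then for every `g` some `k < p` has `g y g⁻¹ y⁻ᵏ ∈ N`.
[cite: Shimura1998, §8.2 Prop. 26 and §32.10] -/
theorem exists_conj_pow_mod_of_forall_isNondegenerate' (N : Subgroup (K ≃ₐ[ℚ] K)) [N.Normal]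
    (hc : (IsCMField.complexConj K).restrictScalars ℚ ∉ N) (p n : ℕ) [Fact p.Prime] (hidx : N.index = 2 * p * n)
    (hcount : ∀ m, 2 ≤ m → m ∣ n →
      (2 * p * n - 1 - m * (p - 1)) * 2 ^ (n / 2) + m * (p - 1) * 2 ^ ((n + (p - 1) * (n / m)) / p) < 2 ^ n)
    (hgood : ∀ (Φ : CMType K) (φ : K →+* ℂ), IsPrimitive (ℂ ≃+* ℂ) Φ.1 φ → IsNondegenerate Φ)
    (y : K ≃ₐ[ℚ] K) (hy : y ∉ N) (hyp : y ^ p ∈ N) (g : K ≃ₐ[ℚ] K) : ∃ k < p, g * y * g⁻¹ * (y ^ k)⁻¹ ∈ N := by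
  by_contra h
  push Not at h
  obtain ⟨Φ, φ, X, ι, ϑ, H1, H2, -⟩ :=
    exists_simple_degenerate_of_nonnormal_prime_order_mod' N hc p n hidx hcount y g hy hyp h
  exact H2 (hgood Φ φ H1)

end Summit.HodgeConjecture.CorCM.GaloisModels

end
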